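/-
Copyright (c) 2026 the pub-hodgecm-mathlib formalisation cell (harness21).  Prover seat hodgecm-mathlib-K2Liu-p11 (g2), Track B «K2-LIT»,
#184♮ = hLiu418 = `stmt-HodgeConjecture-24832`; #41 G6-arch (A∞) general `K_w`-type, piece (H2-alg) (LEAD F0P6-plan (g14) BATCH #28 (3), σ20; my spec 14:32Z).
THEOREMS ONLY (no `def`, no `instance`, no notation, no named-fact hypothesis, no `sorry`).
-/
import Summits.HodgeConjecture.HodgeConjecture.Theorems.K2LiuArchSWOnePlaceRegion     -- ★ S2-asm FILE 2 (K2Liu-p14): `op_re_add_I_smul_im`, `cayley_re/im_mem_lie` (+ ★ FILE 1′ `hasDerivAt_section_kU_exp_evalAt'`, DEFS)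
import HarnessLib

/-!
# Crux `HLiu418`, G6-arch (A∞), (H2-alg): ONE RUNG OF THE `K_w`-TYPE LADDER FOR THE INTERTWINING OPERATOR, in the compact picture
# — from the SWAP binder («`M*_w` commutes with `d∕dt` along `exp tX`») to `cp (M* F₁) = (b c ∕ a) • P₁`

Cell `hodgecm-mathlib`, crux item hLiu418 = `stmt-HodgeConjecture-24832` (helper lane `--supports`, count-neutral).

SECTIONS ONLY, no operator object for `M*_w(s)`: `G ∈ I_w(s′, χ_k)` (think `G = M*_w(s) F`, `s′ = −s`) with compact picture `c • P`; a complex block quadruple `(α,β,γ,δ)`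
(`(0, E_{ab}, 0, 0)` for the arrow `P_{ab}`, `(0, 0, E_{ab}, 0)` for `M_{ab}`) with θ₀-real parts `X₁ = C·re(αβγδ)·C′`, `X₂ = C·im(αβγδ)·C′ ∈ 𝔲(J)` (★ `cayley_re/im_mem_lie`);
SWAP BINDER ((H2-an), the one analytic input): sections `D₁, D₂` with `HasDerivAt (t ↦ G (k_u · exp (t•X_j))) (D_j (k_u)) 0` for all unitary `u`; LINEARITY letter
`D₁ + i D₂ = a · G₁` (= `M*(X₁F + iX₂F) = M*(a F₁)`); ARROW at the target parameter: `Op^{(s′)}_{(αβγδ)} P = b • P₁` (★ S2-T).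
* §1 `op_smul` — ★ FILE 1′'s operator `Op_{(αβγδ)}^{(k,s′)}` is ℂ-linear in `P`;
* §2 **`apply_kU_eq_evalAt_op_of_hasDerivAt`** — ★ FILE 1′ + `HasDerivAt.unique`: the swap binder forces `D (k_u) = ev_u (Op_X^{(s′)} Q)` for a REAL `X`;
* §3 **`rung_step`** — `a · G₁(k_u) = c · b · ev_u(P₁)` for every unitary `u`, i.e. `cp G₁ = (b c ∕ a) • P₁`: the `hTy`-free step of ★ (H1) §4 `apply_target_eq_smul` AT THE
  INSTANCE; iterate along a live path (★ `apply_end_eq_smul` shape) and feed ★ (H4-gen) `exists_package_of_path_finset` for the package `(P_{k,l}, G_{k,l})`.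
References: [LeeZhu1998, §5 p. 5032]; [Knapp1986, Ch. VIII §3]; [Shimura1997, §16.4].
HONEST LABEL: HC_CM is proved only modulo the 7 printed citations (2 remaining named inputs: hLiu418 = stmt-HodgeConjecture-24832,
h413 = stmt-HodgeConjecture-24833) until rung 0 closes; count-neutral helper, closes no socket.
-/

set_option autoImplicit false
set_option linter.dupNamespace false

noncomputable section

open scoped ComplexConjugate
open Complex Matrix NormedSpace
open Summit.HodgeConjecture.HodgeConjecture.Cruxes.HLiu418.K2LiuArchInducedTubeDefs
open Summit.HodgeConjecture.HodgeConjecture.Cruxes.HLiu418.K2LiuU22CompactPictureDefs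
open Summit.HodgeConjecture.HodgeConjecture.Cruxes.HLiu418.K2LiuU22CompactPictureOperatorDictionary
open Summit.HodgeConjecture.HodgeConjecture.Cruxes.HLiu418.K2LiuArchSWOnePlaceRegion

namespace Summit.HodgeConjecture.HodgeConjecture.Cruxes.HLiu418.K2LiuArchIntertwiningKTypeLadder

/-! ## §1  Linearity of ★ FILE 1′'s operator in the compact-picture vector -/

/-- ★ FILE 1′'s operator `Op_{(αβγδ)}^{(k,s′)} P = Σ β P + Σ γ M + (−k·tr α) P − Σ α L + Σ δ R` is ℂ-linear in `P`: `Op (c • P) = c • Op P`. [LeeZhu1998, §5] -/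
theorem op_smul (k : ℤ) (s' : ℂ) (α β γ δ : Matrix (Fin 2) (Fin 2) ℂ) (c : ℂ) (P : Carrier) :
    (∑ a' : Fin 2, ∑ b' : Fin 2, β a' b' • pOp pd uMat dInv (s' + 1 + (-(k : ℂ)) / 2) a' b' (c • P) +
          ∑ a' : Fin 2, ∑ b' : Fin 2, γ a' b' • mOp pd uMat (s' + 1 - (-(k : ℂ)) / 2) a' b' (c • P) + ((-(k : ℂ)) * (α).trace) • (c • P) -
          ∑ a' : Fin 2, ∑ b' : Fin 2, α a' b' • lOp pd uMat a' b' (c • P) + ∑ a' : Fin 2, ∑ b' : Fin 2, δ a' b' • rOp pd uMat a' b' (c • P)) =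
      c • (∑ a' : Fin 2, ∑ b' : Fin 2, β a' b' • pOp pd uMat dInv (s' + 1 + (-(k : ℂ)) / 2) a' b' P +
          ∑ a' : Fin 2, ∑ b' : Fin 2, γ a' b' • mOp pd uMat (s' + 1 - (-(k : ℂ)) / 2) a' b' P + ((-(k : ℂ)) * (α).trace) • P -
          ∑ a' : Fin 2, ∑ b' : Fin 2, α a' b' • lOp pd uMat a' b' P + ∑ a' : Fin 2, ∑ b' : Fin 2, δ a' b' • rOp pd uMat a' b' P) := by
  simp only [map_smul, smul_add, smul_sub, Finset.smul_sum, smul_comm _ c]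

/-! ## §2  The swap binder read through ★ FILE 1′ -/

/-- **THE SWAP BINDER FORCES THE COMPACT PICTURE OF THE DERIVATIVE** (real `X = C·(αβγδ)·C′ ∈ 𝔲(J)`): if `G ∈ I(s′, χ_k)` has compact picture `Q` and
`t ↦ G(k_u exp tX)` has derivative `D(k_u)` at `0` for every unitary `u`, then `D(k_u) = ev_u(Op_X^{(k,s′)} Q)` (★ FILE 1′ + uniqueness of derivatives).
[Knapp1986, Ch. VIII §3] [LeeZhu1998, §5] -/
theorem apply_kU_eq_evalAt_op_of_hasDerivAt (k : ℤ) (s' : ℂ) {G D : Matrix (Fin 2 ⊕ Fin 2) (Fin 2 ⊕ Fin 2) ℂ → ℂ}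
    (hG : IsArchSiegelSection (fun z : ℂ => (conj z / ((‖z‖ : ℝ) : ℂ)) ^ k) s' G) (Q : Carrier)
    (hGQ : ∀ (v : Matrix (Fin 2) (Fin 2) ℂ), vᴴ * v = 1 → ∀ hv : v.det ≠ 0,
      G ((2 : ℂ)⁻¹ • fromBlocks (1 + v) (-(I • (1 - v))) (I • (1 - v)) (1 + v)) = evalAt v hv Q)
    (α β γ δ : Matrix (Fin 2) (Fin 2) ℂ)
    (hX : (fromBlocks 1 1 (I • 1) (-(I • 1)) * fromBlocks α β γ δ * ((2 : ℂ)⁻¹ • fromBlocks 1 (-(I • 1)) 1 (I • 1)) : Matrix (Fin 2 ⊕ Fin 2) (Fin 2 ⊕ Fin 2) ℂ)ᴴ *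
        Matrix.J (Fin 2) ℂ + Matrix.J (Fin 2) ℂ * (fromBlocks 1 1 (I • 1) (-(I • 1)) * fromBlocks α β γ δ * ((2 : ℂ)⁻¹ • fromBlocks 1 (-(I • 1)) 1 (I • 1))) = 0)
    (hD : ∀ u : Matrix (Fin 2) (Fin 2) ℂ, uᴴ * u = 1 →
      HasDerivAt (fun t : ℝ => G (((2 : ℂ)⁻¹ • fromBlocks (1 + u) (-(I • (1 - u))) (I • (1 - u)) (1 + u) : Matrix (Fin 2 ⊕ Fin 2) (Fin 2 ⊕ Fin 2) ℂ) *
        exp (t • (fromBlocks 1 1 (I • 1) (-(I • 1)) * fromBlocks α β γ δ * ((2 : ℂ)⁻¹ • fromBlocks 1 (-(I • 1)) 1 (I • 1)) : Matrix (Fin 2 ⊕ Fin 2) (Fin 2 ⊕ Fin 2) ℂ))))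
        (D ((2 : ℂ)⁻¹ • fromBlocks (1 + u) (-(I • (1 - u))) (I • (1 - u)) (1 + u))) 0)
    {u : Matrix (Fin 2) (Fin 2) ℂ} (hu : uᴴ * u = 1) (hu' : u.det ≠ 0) :
    D ((2 : ℂ)⁻¹ • fromBlocks (1 + u) (-(I • (1 - u))) (I • (1 - u)) (1 + u)) =
      evalAt u hu' (∑ a : Fin 2, ∑ b : Fin 2, β a b • pOp pd uMat dInv (s' + 1 + (-(k : ℂ)) / 2) a b Q +
          ∑ a : Fin 2, ∑ b : Fin 2, γ a b • mOp pd uMat (s' + 1 - (-(k : ℂ)) / 2) a b Q + ((-(k : ℂ)) * α.trace) • Q -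
          ∑ a : Fin 2, ∑ b : Fin 2, α a b • lOp pd uMat a b Q + ∑ a : Fin 2, ∑ b : Fin 2, δ a b • rOp pd uMat a b Q) :=
  (hD u hu).unique (hasDerivAt_section_kU_exp_evalAt' k s' hG Q hGQ hu hu' α β γ δ hX)

/-! ## §3  One rung -/

/-- **ONE RUNG OF THE LADDER.**  See the module docstring: with `cp G = c • P`, the two real swap binders, the linearity letter `D₁ + i D₂ = a · G₁` and the arrow
`Op^{(k,s′)}_{(αβγδ)} P = b • P₁`, one gets `a · G₁(k_u) = c · b · ev_u(P₁)` for every unitary `u` — i.e. `cp G₁ = (b c ∕ a) • P₁` on a live arrow. [LeeZhu1998, §5 p. 5032] -/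
theorem rung_step (k : ℤ) (s' : ℂ) {G D₁ D₂ G₁ : Matrix (Fin 2 ⊕ Fin 2) (Fin 2 ⊕ Fin 2) ℂ → ℂ}
    (hG : IsArchSiegelSection (fun z : ℂ => (conj z / ((‖z‖ : ℝ) : ℂ)) ^ k) s' G) (c : ℂ) (P P₁ : Carrier)
    (hGP : ∀ (v : Matrix (Fin 2) (Fin 2) ℂ), vᴴ * v = 1 → ∀ hv : v.det ≠ 0,
      G ((2 : ℂ)⁻¹ • fromBlocks (1 + v) (-(I • (1 - v))) (I • (1 - v)) (1 + v)) = evalAt v hv (c • P))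
    (α β γ δ : Matrix (Fin 2) (Fin 2) ℂ)
    (hD₁ : ∀ u : Matrix (Fin 2) (Fin 2) ℂ, uᴴ * u = 1 →
      HasDerivAt (fun t : ℝ => G (((2 : ℂ)⁻¹ • fromBlocks (1 + u) (-(I • (1 - u))) (I • (1 - u)) (1 + u) : Matrix (Fin 2 ⊕ Fin 2) (Fin 2 ⊕ Fin 2) ℂ) *
        exp (t • (fromBlocks 1 1 (I • 1) (-(I • 1)) *
          fromBlocks ((2 : ℂ)⁻¹ • (α - αᴴ)) ((2 : ℂ)⁻¹ • (β + γᴴ)) ((2 : ℂ)⁻¹ • (γ + βᴴ)) ((2 : ℂ)⁻¹ • (δ - δᴴ)) *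
          ((2 : ℂ)⁻¹ • fromBlocks 1 (-(I • 1)) 1 (I • 1)) : Matrix (Fin 2 ⊕ Fin 2) (Fin 2 ⊕ Fin 2) ℂ))))
        (D₁ ((2 : ℂ)⁻¹ • fromBlocks (1 + u) (-(I • (1 - u))) (I • (1 - u)) (1 + u))) 0)
    (hD₂ : ∀ u : Matrix (Fin 2) (Fin 2) ℂ, uᴴ * u = 1 →
      HasDerivAt (fun t : ℝ => G (((2 : ℂ)⁻¹ • fromBlocks (1 + u) (-(I • (1 - u))) (I • (1 - u)) (1 + u) : Matrix (Fin 2 ⊕ Fin 2) (Fin 2 ⊕ Fin 2) ℂ) *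
        exp (t • (fromBlocks 1 1 (I • 1) (-(I • 1)) *
          fromBlocks ((2 * I : ℂ)⁻¹ • (α + αᴴ)) ((2 * I : ℂ)⁻¹ • (β - γᴴ)) ((2 * I : ℂ)⁻¹ • (γ - βᴴ)) ((2 * I : ℂ)⁻¹ • (δ + δᴴ)) *
          ((2 : ℂ)⁻¹ • fromBlocks 1 (-(I • 1)) 1 (I • 1)) : Matrix (Fin 2 ⊕ Fin 2) (Fin 2 ⊕ Fin 2) ℂ))))
        (D₂ ((2 : ℂ)⁻¹ • fromBlocks (1 + u) (-(I • (1 - u))) (I • (1 - u)) (1 + u))) 0)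
    (a b : ℂ) (hlin : ∀ g, D₁ g + I * D₂ g = a * G₁ g)
    (hb : (∑ a' : Fin 2, ∑ b' : Fin 2, β a' b' • pOp pd uMat dInv (s' + 1 + (-(k : ℂ)) / 2) a' b' P +
          ∑ a' : Fin 2, ∑ b' : Fin 2, γ a' b' • mOp pd uMat (s' + 1 - (-(k : ℂ)) / 2) a' b' P + ((-(k : ℂ)) * (α).trace) • P -
          ∑ a' : Fin 2, ∑ b' : Fin 2, α a' b' • lOp pd uMat a' b' P + ∑ a' : Fin 2, ∑ b' : Fin 2, δ a' b' • rOp pd uMat a' b' P) = b • P₁)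
    {u : Matrix (Fin 2) (Fin 2) ℂ} (hu : uᴴ * u = 1) (hu' : u.det ≠ 0) :
    a * G₁ ((2 : ℂ)⁻¹ • fromBlocks (1 + u) (-(I • (1 - u))) (I • (1 - u)) (1 + u)) = c * b * evalAt u hu' P₁ := by
  have h₁ := apply_kU_eq_evalAt_op_of_hasDerivAt k s' hG (c • P) hGP _ _ _ _ (cayley_re_mem_lie α β γ δ) hD₁ hu hu'
  have h₂ := apply_kU_eq_evalAt_op_of_hasDerivAt k s' hG (c • P) hGP _ _ _ _ (cayley_im_mem_lie α β γ δ) hD₂ hu hu'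
  rw [← hlin, h₁, h₂, ← smul_eq_mul I, ← map_smul, ← map_add, ← op_re_add_I_smul_im k s' α β γ δ (c • P), op_smul, hb, map_smul, map_smul,
    smul_eq_mul, smul_eq_mul, mul_assoc]

end Summit.HodgeConjecture.HodgeConjecture.Cruxes.HLiu418.K2LiuArchIntertwiningKTypeLadder

end
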